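import Summits.ResolutionOfSingularities.ResolutionOfSingularities.Theorems.FrobeniusClosingPatchingRelPerfectDepthTargetsDefs
import Summits.ResolutionOfSingularities.ResolutionOfSingularities.Theorems.FrobeniusClosingPatchingRelPerfectDepthOneDictionaryStepPow
import HarnessLib

/-!
# Crux `PatchingRelPerfect` (stmt-ResolutionOfSingularities-16161), chain w52 — rung R4 support,
# TARGET D_ℓ BY NAME: `DepthTargets.DictionaryStepPow ℓ` holds for every `ℓ`

[OURS · L1 W5.2 · rung tool] plan-1 g6 typed targets F1 (`…DepthTargetsDefs.lean`, TargetsF1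
1f958573273f59ec), assignment (a) to res-L1-w52-stub-5: the depth-`ℓ` dictionary step `DictionaryStepPow ℓ`
is closed by repackaging the by-content theorem `DepthOne.dictionaryStep_pow_controlledTransform`
(`…DepthOneDictionaryStepPow.lean`, p497259): the nine fields of `DepthInvariant` are fed in and collected,
`i' := Bl(i)` is the strict-transform morphism (`i' ≫ σ = τ ≫ i` by `IsBlowup.strictTransformHom_comp`),
`M' := σ^*M · 𝓘_{exc}^ℓ`, `K' := σᶜ(K, ℓ)`, and `K'|_{E'} = τᶜ(K|_E, ℓ)`. Nothing here is a statement of the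
manuscript under review.
-/

-- `Summit.<Summit>.<Sub>.Theorems` with `Sub = Summit` (single-conjunct summit, D-0017)
set_option linter.dupNamespace false

noncomputable section

open CategoryTheory AlgebraicGeometry Literature.AlgebraicGeometry.Resolution

namespace Summit.ResolutionOfSingularities.ResolutionOfSingularities.Theorems

universe u

namespace DepthTargets

/-- **D_ℓ by name**: plan-1's typed target `DepthTargets.DictionaryStepPow ℓ` — one permissible step on
the exceptional threefold (`K ≤ Ĉ^ℓ`) is matched by one blowing up of the ambient fourfold preserving
`DepthInvariant ℓ`, the weight-`ℓ` initial ideal `K|_E` transforming by its weight-`ℓ` controlled transform —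
holds for every `ℓ`, from `DepthOne.dictionaryStep_pow_controlledTransform`.
[cite: GortzWedhorn2020, Prop. 13.91 (1), Prop. 13.96 (2)] [cite: BierstoneGrigorievMilmanWlodarczyk2011, §3.2 Lemma 3.2.1] -/
theorem dictionaryStepPow_holds : ∀ ℓ : ℕ, DictionaryStepPow.{u} ℓ := by
  intro ℓ S _ _ I E X i g K h E' τ C hC hKC hτ
  haveI := h.isNoetherian
  haveI := h.isClosedImmersion
  obtain ⟨M, hM, hIMK⟩ := h.exists_format
  obtain ⟨X', σ, hσ, hτ', h1, h2, h3, h4, h5, -, h7, h8, h9, h10, h11, h12⟩ :=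
    DepthOne.dictionaryStep_pow_controlledTransform I ℓ i g h.isRegular h.isRegular_exc
      h.isEffectiveCartier_ker h.map_eq_closedPoint h.exists_isBlowup_supported M K hM h.ker_pow_le hIMK
      τ C hC hKC hτ
  exact ⟨X', σ, hσ.strictTransformHom hτ', hσ, hσ.strictTransformHom_comp hτ',
    ⟨h1, h2, h3, h4, h5, h7, h8, h10, ⟨_, h9, h12⟩⟩, h11⟩

end DepthTargets

end Summit.ResolutionOfSingularities.ResolutionOfSingularities.Theorems

end
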